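import Literature.Analysis.Pluripotential.LaplacianSubMeanValue
import Literature.Analysis.Complex.PlancherelPolyaProofs
import Mathlib.Analysis.SpecialFunctions.Integrals.PosLogEqCircleAverage
import HarnessLib

/-!
# E. Hopf's boundary point lemma for `C²` subharmonic functions on a disc

Topic `Literature/Analysis/Pluripotential`.  Gilbarg–Trudinger, *Elliptic Partial Differential
Equations of Second Order*, Lemma 3.4 (Hopf's boundary point lemma), in the special case of the
Laplacian on a disc in `ℝ² = ℂ` and a `C²` subsolution: **if `v ∈ C²` near the closed disc
`D̄(c, R)`, `Δv ≥ 0` in the open disc, and `v < v(p)` in the open disc for a boundary point `p`,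
then the outward radial derivative of `v` at `p` is strictly positive**,
`Dv(p)(p - c) > 0` (`pos_fderiv_of_laplacian_nonneg_of_lt`).  In particular `Dv(p) ≠ 0` even
though `p` is a maximum point of `v` on the closed disc.

Proof with the HARMONIC barrier `h(x) = log R - log |x - c|` on the annulus
`R/2 ≤ |x - c| ≤ R` (so that no second derivatives of the barrier are needed): `h = 0` on the
outer circle, `h = log 2` on the inner one, `h` has the mean-value property on circles inside the
annulus (`circleAverage_log_norm_sub_of_lt`), and `v` has the sub-mean-value property there
(`le_circleAverage_of_laplacian_nonneg_of_contDiffOn`, Hörmander Thm. 1.6.3); by compactness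
`v ≤ v(p) - δ` on the inner circle, so for `ε = δ/2` the function `w = v - v(p) + ε h` is `≤ 0` on
both circles and has the sub-mean-value property inside, hence `w ≤ 0` on the annulus by the
weak maximum principle (`Literature.Analysis.Complex.le_on_of_subMeanValue_of_le_on_boundary`).
Along the radius `x_t = c + t(p - c)`, `t ∈ (1/2, 1)`, this reads `v(x_t) - v(p) ≤ ε log t`;
dividing by `t - 1 < 0` and letting `t → 1⁻` gives `Dv(p)(p - c) ≥ ε > 0`.

* `circleAverage_log_norm_sub_of_lt` — mean-value property of `log |· - a|` on circles not
  enclosing `a`;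
* `le_of_lt_on_ball` — `v < M` on the open disc and `v` continuous on the closed disc give
  `v ≤ M` on the closed disc;
* **`pos_fderiv_of_laplacian_nonneg_of_lt`** — Hopf's lemma.

Everything is proved; no definition, no named fact.  Used for the transversality of
`J`-holomorphic discs to the `J`-convex boundary of a Stein domain (Eliashberg (1990), §1.1:
*"`C` is transversal to `∂Ω` in all regular points of its boundary `∂C`"*).

## References

* D. Gilbarg, N. S. Trudinger, *Elliptic Partial Differential Equations of Second Order*,
  Classics in Mathematics, Springer (2001, reprint of the 2nd ed.), Lemma 3.4. [GilbargTrudinger2001]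
* L. Hörmander, *An Introduction to Complex Analysis in Several Variables* (1973), Thm. 1.6.3.
  [HormanderSCV1973]
-/

noncomputable section

open scoped Topology Real
open Set Metric Filter Complex

namespace Literature.Analysis.Pluripotential

/-- **Mean-value property of `log |· - a|`** on circles not enclosing `a`: for
`0 < r < |z - a|`, `(2π)⁻¹ ∫₀^{2π} log |z + re^{iθ} - a| dθ = log |z - a|` (Mathlib's
`circleAverage_log_norm_sub_const_eq_log_radius_add_posLog`). [folklore] -/
theorem circleAverage_log_norm_sub_of_lt {z a : ℂ} {r : ℝ} (hr : 0 < r) (hz : r < ‖z - a‖) :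
    Real.circleAverage (fun x : ℂ => Real.log ‖x - a‖) z r = Real.log ‖z - a‖ := by
  have h1 := circleAverage_log_norm_sub_const_eq_log_radius_add_posLog (c := z) (a := a) hr.ne'
  have hc0 : 0 < ‖z - a‖ := hr.trans hz
  have hone : 1 ≤ r⁻¹ * ‖z - a‖ := by
    rw [le_inv_mul_iff₀ hr, mul_one]; exact hz.le
  have h2 : Real.posLog (r⁻¹ * ‖z - a‖) = Real.log (r⁻¹ * ‖z - a‖) :=
    Real.posLog_eq_log (by rwa [abs_of_nonneg (by positivity)])
  rw [h2, Real.log_mul (inv_ne_zero hr.ne') hc0.ne', Real.log_inv] at h1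
  rw [h1]
  ring

/-- A function continuous on the closed disc and `< M` on the open disc is `≤ M` on the closed
disc (approach a boundary point along its radius). [folklore] -/
theorem le_of_lt_on_ball {v : ℂ → ℝ} {c : ℂ} {R M : ℝ} (hR : 0 < R)
    (hvc : ContinuousOn v (closedBall c R)) (hlt : ∀ z ∈ ball c R, v z < M) :
    ∀ z ∈ closedBall c R, v z ≤ M := by
  intro z hz
  by_cases hzb : z ∈ ball c R
  · exact (hlt z hzb).le
  · -- `z` is on the boundary circle: approach it along the radius
    have hzR : dist z c = R := le_antisymm (mem_closedBall.1 hz) (not_lt.1 fun h => hzb h)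
    set γ : ℝ → ℂ := fun t => c + (t : ℂ) * (z - c) with hγ
    have hγc : Continuous γ := by
      simp only [hγ]; fun_prop
    have hγ1 : γ 1 = z := by simp [hγ]
    have hγmem : ∀ t ∈ Icc (0 : ℝ) 1, γ t ∈ closedBall c R := by
      intro t ht
      rw [mem_closedBall, dist_eq_norm]
      have : γ t - c = (t : ℂ) * (z - c) := by simp [hγ]
      rw [this, norm_mul, Complex.norm_real, Real.norm_eq_abs, abs_of_nonneg ht.1,
        ← dist_eq_norm, hzR]
      nlinarith [ht.2]
    have hγball : ∀ t ∈ Ico (0 : ℝ) 1, γ t ∈ ball c R := by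
      intro t ht
      rw [mem_ball, dist_eq_norm]
      have : γ t - c = (t : ℂ) * (z - c) := by simp [hγ]
      rw [this, norm_mul, Complex.norm_real, Real.norm_eq_abs, abs_of_nonneg ht.1,
        ← dist_eq_norm, hzR]
      nlinarith [ht.2]
    have hcomp : ContinuousWithinAt (v ∘ γ) (Icc 0 1) 1 :=
      (hvc.comp hγc.continuousOn hγmem).continuousWithinAt ⟨zero_le_one, le_rfl⟩
    have hT : Tendsto (v ∘ γ) (𝓝[Ico (0 : ℝ) 1] 1) (𝓝 (v z)) := by
      have := hcomp.tendsto
      rw [Function.comp_apply, hγ1] at this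
      exact this.mono_left (nhdsWithin_mono _ Ico_subset_Icc_self)
    haveI : (𝓝[Ico (0 : ℝ) 1] (1 : ℝ)).NeBot := by
      rw [← mem_closure_iff_nhdsWithin_neBot, closure_Ico zero_ne_one]
      exact ⟨zero_le_one, le_rfl⟩
    exact le_of_tendsto hT (eventually_nhdsWithin_of_forall fun t ht => (hlt _ (hγball t ht)).le)

/-- **E. Hopf's boundary point lemma for `C²` subharmonic functions on a disc**
(Gilbarg–Trudinger, Lemma 3.4, for `L = Δ` in `ℝ²`).  Let `v` be `C²` on an open set
`U ⊇ D̄(c, R)` (`R > 0`), with `Δv = D²v(1,1) + D²v(i,i) ≥ 0` on the open disc `D(c, R)`, and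
let `p ∈ ∂D(c, R)` with `v(z) < v(p)` for all `z ∈ D(c, R)`.  Then the outward radial derivative
is strictly positive: `Dv(p)(p - c) > 0`.  (Harmonic barrier `log R - log |x - c|` on the annulus
`R/2 ≤ |x - c| ≤ R`, weak maximum principle for sub-mean-value functions, limit along the
radius; see the module docstring.) [cite: GilbargTrudinger2001, Lemma 3.4] -/
theorem pos_fderiv_of_laplacian_nonneg_of_lt {v : ℂ → ℝ} {U : Set ℂ} (hU : IsOpen U)
    (hv : ContDiffOn ℝ 2 v U) {c : ℂ} {R : ℝ} (hR : 0 < R) (hcl : closedBall c R ⊆ U)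
    (hΔ : ∀ z ∈ ball c R, 0 ≤ fderiv ℝ (fderiv ℝ v) z 1 1 + fderiv ℝ (fderiv ℝ v) z I I)
    {p : ℂ} (hp : p ∈ sphere c R) (hlt : ∀ z ∈ ball c R, v z < v p) :
    0 < fderiv ℝ v p (p - c) := by
  set M : ℝ := v p with hM
  have hvc : ContinuousOn v (closedBall c R) := hv.continuousOn.mono hcl
  have hle : ∀ z ∈ closedBall c R, v z ≤ M := le_of_lt_on_ball hR hvc hlt
  have hpR : ‖p - c‖ = R := by rwa [mem_sphere, dist_eq_norm] at hp
  -- `δ > 0` with `v ≤ M - δ` on the inner circle `|z - c| = R/2`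
  have hR2 : 0 < R / 2 := half_pos hR
  obtain ⟨z₁, hz₁, hmax₁⟩ := (isCompact_sphere c (R / 2)).exists_isMaxOn
    (NormedSpace.sphere_nonempty.2 hR2.le) (hvc.mono (sphere_subset_closedBall.trans
      (closedBall_subset_closedBall (by linarith))))
  have hz₁ball : z₁ ∈ ball c R := by
    rw [mem_ball]; rw [mem_sphere] at hz₁; linarith
  set δ : ℝ := M - v z₁ with hδ
  have hδ0 : 0 < δ := sub_pos.2 (hlt z₁ hz₁ball)
  have hinner : ∀ z ∈ sphere c (R / 2), v z ≤ M - δ := fun z hz => by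
    have h' : v z ≤ v z₁ := hmax₁ hz
    rw [hδ]; linarith
  -- the barrier and the comparison function
  set ε : ℝ := δ / 2 with hε
  have hε0 : 0 < ε := by positivity
  set h : ℂ → ℝ := fun x => Real.log R - Real.log ‖x - c‖ with hh
  set w : ℂ → ℝ := fun x => v x - M + ε * h x with hw
  set K : Set ℂ := {x : ℂ | R / 2 ≤ ‖x - c‖ ∧ ‖x - c‖ ≤ R} with hK
  set B : Set ℂ := {x : ℂ | ‖x - c‖ = R / 2 ∨ ‖x - c‖ = R} with hB
  have hKsub : K ⊆ closedBall c R := fun x hx => by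
    rw [mem_closedBall, dist_eq_norm]; exact hx.2
  have hKc : IsCompact K := by
    refine (isCompact_closedBall c R).of_isClosed_subset ?_ hKsub
    exact (isClosed_le continuous_const (continuous_id.sub continuous_const).norm).inter
      (isClosed_le (continuous_id.sub continuous_const).norm continuous_const)
  have hK0 : ∀ x ∈ K, x - c ≠ 0 := fun x hx h0 => by
    have hx' : R / 2 ≤ ‖x - c‖ := hx.1
    rw [h0, norm_zero] at hx'
    linarith
  have hhc : ContinuousOn h K :=
    continuousOn_const.sub (((continuous_id.sub continuous_const).norm.continuousOn).log
      fun x hx => (norm_pos_iff.2 (hK0 x hx)).ne')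
  have hwc : ContinuousOn w K := ((hvc.mono hKsub).sub continuousOn_const).add
    (continuousOn_const.mul hhc)
  -- sub-mean-value of `w` at interior points of the annulus
  have hwsub : ∀ z ∈ K \ B, ∃ r₀ > 0, closedBall z r₀ ⊆ K ∧
      ∀ r ∈ Ioo 0 r₀, w z ≤ Real.circleAverage w z r := by
    rintro z ⟨hzK, hzB⟩
    have h1 : R / 2 < ‖z - c‖ := lt_of_le_of_ne hzK.1 fun h => hzB (Or.inl h.symm)
    have h2 : ‖z - c‖ < R := lt_of_le_of_ne hzK.2 fun h => hzB (Or.inr h)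
    refine ⟨min (‖z - c‖ - R / 2) (R - ‖z - c‖), lt_min (sub_pos.2 h1) (sub_pos.2 h2), ?_, ?_⟩
    · intro x hx
      rw [mem_closedBall, dist_eq_norm] at hx
      have hle1 := hx.trans (min_le_left _ _)
      have hle2 := hx.trans (min_le_right _ _)
      have t1 : ‖z - c‖ - ‖x - z‖ ≤ ‖x - c‖ := by
        have := norm_sub_norm_le (z - c) (z - x)
        rw [show z - c - (z - x) = x - c by ring, norm_sub_rev z x] at this
        linarith
      have t2 : ‖x - c‖ ≤ ‖z - c‖ + ‖x - z‖ := by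
        have := norm_add_le (z - c) (x - z)
        rwa [show z - c + (x - z) = x - c by ring] at this
      exact ⟨by linarith, by linarith⟩
    · intro r hr
      have hrz : r < ‖z - c‖ := by
        have := hr.2.trans_le (min_le_left _ _); linarith
      have hrR : r < R - ‖z - c‖ := hr.2.trans_le (min_le_right _ _)
      -- the closed disc `D̄(z, r)` lies in the open disc `D(c, R)` (and in `U`)
      have hdisc : closedBall z r ⊆ ball c R := by
        intro x hx
        rw [mem_closedBall, dist_eq_norm] at hx
        rw [mem_ball, dist_eq_norm]
        have t2 : ‖x - c‖ ≤ ‖z - c‖ + ‖x - z‖ := by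
          have := norm_add_le (z - c) (x - z)
          rwa [show z - c + (x - z) = x - c by ring] at this
        linarith
      have hdiscU : closedBall z r ⊆ U := hdisc.trans (ball_subset_closedBall.trans hcl)
      -- sub-mean-value of `v`, mean value of `h`
      have hvz : v z ≤ Real.circleAverage v z r :=
        le_circleAverage_of_laplacian_nonneg_of_contDiffOn hU hv hdiscU
          (fun x hx => hΔ x (hdisc hx)) hr.1 le_rfl
      have hv_int : CircleIntegrable v z r :=
        (hvc.mono ((sphere_subset_closedBall.trans (by
          rw [abs_of_pos hr.1]; exact hdisc.trans ball_subset_closedBall)))).circleIntegrable'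
      have hsphere0 : ∀ x ∈ sphere z |r|, x - c ≠ 0 := by
        intro x hx
        rw [abs_of_pos hr.1] at hx
        have hxK : R / 2 < ‖x - c‖ := by
          have hx' : ‖x - z‖ = r := by rwa [mem_sphere, dist_eq_norm] at hx
          have t1 : ‖z - c‖ - ‖x - z‖ ≤ ‖x - c‖ := by
            have := norm_sub_norm_le (z - c) (z - x)
            rw [show z - c - (z - x) = x - c by ring, norm_sub_rev z x] at this
            linarith
          have : r < ‖z - c‖ - R / 2 := hr.2.trans_le (min_le_left _ _)
          linarith
        intro h0; rw [h0, norm_zero] at hxK; linarith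
      have hlog_int : CircleIntegrable (fun x : ℂ => Real.log ‖x - c‖) z r :=
        ContinuousOn.circleIntegrable' (((continuous_id.sub continuous_const).norm.continuousOn).log
          fun x hx => (norm_pos_iff.2 (hsphere0 x hx)).ne')
      have hh_int : CircleIntegrable h z r := by
        have := (circleIntegrable_const (Real.log R) z r).sub hlog_int
        exact this
      have hhz : Real.circleAverage h z r = h z := by
        show Real.circleAverage (fun x => Real.log R - Real.log ‖x - c‖) z r = _
        rw [Real.circleAverage_fun_sub (circleIntegrable_const (Real.log R) z r) hlog_int,
          Real.circleAverage_const, circleAverage_log_norm_sub_of_lt hr.1 hrz]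
      have hεh_int : CircleIntegrable (fun x => ε * h x) z r := by
        have := hh_int.const_fun_smul (a := ε)
        simpa [smul_eq_mul] using this
      have hvM_int : CircleIntegrable (fun x => v x - M) z r := hv_int.sub (circleIntegrable_const M z r)
      have havg : Real.circleAverage w z r = Real.circleAverage v z r - M + ε * h z := by
        show Real.circleAverage (fun x => v x - M + ε * h x) z r = _
        rw [Real.circleAverage_fun_add hvM_int hεh_int,
          Real.circleAverage_fun_sub hv_int (circleIntegrable_const M z r), Real.circleAverage_const]
        have e2 : Real.circleAverage (fun x => ε * h x) z r = ε * h z := by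
          have := Real.circleAverage_fun_smul (c := z) (R := r) (a := ε) (f := h)
          simp only [smul_eq_mul] at this
          rw [this, hhz]
        rw [e2]
      show v z - M + ε * h z ≤ Real.circleAverage w z r
      rw [havg]
      linarith
  -- boundary values of `w`
  have hlog2 : Real.log 2 ≤ 1 := by
    have := Real.log_le_sub_one_of_pos (two_pos : (0 : ℝ) < 2); linarith
  have hwB : ∀ x ∈ B, w x ≤ 0 := by
    intro x hx
    rcases hx with hx | hx
    · -- inner circle: `h = log 2`, `v ≤ M - δ`
      have hhx : h x = Real.log 2 := by
        simp only [hh, hx]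
        rw [Real.log_div hR.ne' two_ne_zero]
        ring
      have hvx : v x ≤ M - δ := hinner x (by rw [mem_sphere, dist_eq_norm]; exact hx)
      show v x - M + ε * h x ≤ 0
      rw [hhx, hε]
      nlinarith [Real.log_nonneg (by norm_num : (1 : ℝ) ≤ 2)]
    · -- outer circle: `h = 0`, `v ≤ M`
      have hhx : h x = 0 := by simp only [hh, hx, sub_self]
      have hvx : v x ≤ M := hle x (by rw [mem_closedBall, dist_eq_norm]; exact hx.le)
      show v x - M + ε * h x ≤ 0
      rw [hhx, mul_zero, add_zero]
      linarith
  -- weak maximum principle on the annulus: `w ≤ 0` on `K`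
  have hwK : ∀ x ∈ K, w x ≤ 0 :=
    Literature.Analysis.Complex.le_on_of_subMeanValue_of_le_on_boundary hKc hwc hwsub hwB
  -- along the radius through `p`
  set f : ℝ → ℝ := fun t => v (c + (t : ℂ) * (p - c)) with hf
  set g : ℝ → ℝ := fun t => ε * Real.log t with hg
  have hf1 : f 1 = M := by simp [hf, hM]
  have hg1 : g 1 = 0 := by simp [hg]
  have hineq : ∀ t ∈ Ioo (1 / 2 : ℝ) 1, f t - f 1 ≤ g t - g 1 := by
    intro t ht
    have ht0 : 0 < t := by linarith [ht.1]
    set x : ℂ := c + (t : ℂ) * (p - c) with hx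
    have hxc : x - c = (t : ℂ) * (p - c) := by simp [hx]
    have hnorm : ‖x - c‖ = t * R := by
      rw [hxc, norm_mul, Complex.norm_real, Real.norm_eq_abs, abs_of_pos ht0, hpR]
    have hxK : x ∈ K := by
      refine ⟨?_, ?_⟩ <;> rw [hnorm] <;> nlinarith [ht.1, ht.2]
    have hwx := hwK x hxK
    have hhx : h x = -Real.log t := by
      simp only [hh, hnorm]
      rw [Real.log_mul ht0.ne' hR.ne']
      ring
    have : v x - M + ε * h x ≤ 0 := hwx
    rw [hhx] at this
    rw [hf1, hg1, sub_zero]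
    show v x - M ≤ ε * Real.log t
    linarith
  -- derivatives at `t = 1`
  have hpU : p ∈ U := hcl (sphere_subset_closedBall hp)
  have hvd : DifferentiableAt ℝ v p := (hv.contDiffAt (hU.mem_nhds hpU)).differentiableAt (by norm_num)
  have hγ : HasDerivAt (fun t : ℝ => c + (t : ℂ) * (p - c)) (p - c) 1 := by
    have h1 : HasDerivAt (fun t : ℝ => (t : ℂ)) 1 1 := by
      simpa using (hasDerivAt_id (1 : ℝ)).ofReal_comp
    simpa using (h1.mul_const (p - c)).const_add c
  have hfd : HasDerivAt f (fderiv ℝ v p (p - c)) 1 := by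
    have hp1 : c + ((1 : ℝ) : ℂ) * (p - c) = p := by simp
    have hl : HasFDerivAt v (fderiv ℝ v p) (c + ((1 : ℝ) : ℂ) * (p - c)) := by
      rw [hp1]; exact hvd.hasFDerivAt
    exact hl.comp_hasDerivAt (1 : ℝ) hγ
  have hgd : HasDerivAt g ε 1 := by
    have := (Real.hasDerivAt_log one_ne_zero).const_mul ε
    simpa [hg] using this
  -- compare the slopes from the left
  have hTf : Tendsto (slope f 1) (𝓝[<] 1) (𝓝 (fderiv ℝ v p (p - c))) :=
    (hasDerivAt_iff_tendsto_slope.1 hfd).mono_left (nhdsWithin_mono _ fun t ht => ne_of_lt ht)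
  have hTg : Tendsto (slope g 1) (𝓝[<] 1) (𝓝 ε) :=
    (hasDerivAt_iff_tendsto_slope.1 hgd).mono_left (nhdsWithin_mono _ fun t ht => ne_of_lt ht)
  have hev : ∀ᶠ t in 𝓝[<] (1 : ℝ), slope g 1 t ≤ slope f 1 t := by
    filter_upwards [Ioo_mem_nhdsLT (by norm_num : (1 / 2 : ℝ) < 1)] with t ht
    simp only [slope_def_field]
    exact div_le_div_of_nonpos_of_le (by linarith [ht.2]) (hineq t ht)
  exact hε0.trans_le (le_of_tendsto_of_tendsto hTg hTf hev)

end Literature.Analysis.Pluripotential
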